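import Mathlib.Analysis.InnerProductSpace.LinearMap
import HarnessLib

/-!
# The dummy stable direction: running hyperplane dynamics through the whole-space shadowing kernel

Topic `Literature/Dynamics/Hyperbolic`.  The sequence-shadowing kernel `SequenceShadowing*.lean` (Pilyugin's
Theorem 1.3.1 and its periodic package `IsHyperbolicSequence.exists_periodic_shadow_package_of_norm_sub_le`) is
stated for self-maps `φ_k : E → E` of a WHOLE Banach space.  In a closing argument for a SEMIFLOW on a Hilbert space
(Katok 1980 §3 read on local sections as in Lian–Young 2012) the maps one must shadow are Poincaré maps between
sections; after transporting every section to one model hyperplane `H₀ = (ℝ ∙ e₀)ᗮ`, `‖e₀‖ = 1`, they are self-maps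
`F_k` of `H₀`, one dimension short.  The classical bookkeeping remedy is the DUMMY STABLE DIRECTION: extend each map to
`E` by the contraction by `1/2` in the normal direction,

  `Fext v := F (v − ⟪e₀, v⟫ e₀) + (½ ⟪e₀, v⟫) e₀`,   `Aext := A ∘ (1 − P₀) + ½ P₀`,   `P₀ v := ⟪e₀, v⟫ e₀`

(`P₀ = (innerSL ℝ e₀).smulRight e₀ = InnerProductSpace.rankOne ℝ e₀ e₀`).  Everything is written out explicitly (no new
definitions), so that the statements unify with the kernel's hypotheses for `φ_k := Fext_k`, `A'_k := Aext_k`: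

* §1 the hyperplane part `v − ⟪e₀, v⟫ e₀` is orthogonal to `e₀`, has norm `≤ ‖v‖` (Pythagoras) and is `1`-Lipschitz;
* §2 `inner_Fext`: the normal component is halved by the extended map, hence (`inner_eq_zero_of_periodic_trajectory`)
  it VANISHES along every periodic trajectory of the extended maps, which is therefore a genuine trajectory of the
  hyperplane maps (`hyperplane_part_of_periodic_trajectory`): the extension creates no spurious periodic orbits;
  `Fext_zero`: the offsets `Fext 0 = F 0` are unchanged;
* §3 `Aext_apply`, `Aext_apply_self` (`Aext e₀ = ½ e₀`), `Aext_apply_of_inner_eq_zero` (`Aext = A` on `H₀`),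
  `norm_Aext_sub_Aext_le` (`‖Aext' − Aext‖ ≤ ‖A' − A‖`), and `lipschitz_nonlin_Fext`: if `F_k − A_k` is `κ`-Lipschitz
  on the `Δ`-ball then so is `Fext_k − Aext_k`, with the SAME `κ` and `Δ`, in exactly the hypothesis shape `hLip` of
  `exists_periodic_shadow_package_of_norm_sub_le`.

Primed versions carry pointwise hypotheses (a single map, orthogonality only where it is used); the unprimed ones are
the `ℤ`-indexed forms a closing argument consumes.  Not here: hyperbolicity of `(Aext, P)` for a splitting whose
stable part contains `e₀` (an axiom of the chart package), and the transport between sections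
(`Literature/Analysis/InnerProduct/HyperplaneTransport.lean`).

## References

* A. Katok, *Lyapunov exponents, entropy and periodic orbits for diffeomorphisms*, Publ. Math. IHÉS 51 (1980)
  137–173, §3 (Main Lemma). [Katok1980]
* S. Yu. Pilyugin, *Shadowing in Dynamical Systems*, LNM 1706 (1999), §1.3. [Pilyugin1999]
* Z. Lian, L.-S. Young, *Lyapunov exponents, periodic orbits, and horseshoes for semiflows on Hilbert spaces*,
  J. Amer. Math. Soc. 25 (2012) 637–665. [LianYoung2012]
-/

noncomputable section

open scoped InnerProductSpace RealInnerProductSpace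

namespace Literature.Dynamics.Hyperbolic

variable {E : Type*} [NormedAddCommGroup E] [InnerProductSpace ℝ E]

/-! ## §1 The hyperplane part `v − ⟪e₀, v⟫ e₀` of a vector -/

/-- The hyperplane part `v − ⟪e₀, v⟫ e₀` of `v` is orthogonal to the unit vector `e₀`. [folklore] -/
theorem inner_sub_inner_smul_self {e₀ : E} (he : ‖e₀‖ = 1) (v : E) : ⟪e₀, v - ⟪e₀, v⟫_ℝ • e₀⟫_ℝ = 0 := by
  rw [inner_sub_right, real_inner_smul_right, inner_self_eq_one_of_norm_eq_one he, mul_one, sub_self]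

/-- **Pythagoras for the splitting `v = (v − ⟪e₀, v⟫ e₀) + ⟪e₀, v⟫ e₀`**:
`‖v − ⟪e₀, v⟫ e₀‖² = ‖v‖² − ⟪e₀, v⟫²` for a unit vector `e₀`. [folklore] -/
theorem norm_sub_inner_smul_sq {e₀ : E} (he : ‖e₀‖ = 1) (v : E) :
    ‖v - ⟪e₀, v⟫_ℝ • e₀‖ ^ 2 = ‖v‖ ^ 2 - ⟪e₀, v⟫_ℝ ^ 2 := by
  rw [norm_sub_sq_real, real_inner_smul_right, real_inner_comm v e₀, norm_smul, he, mul_one, Real.norm_eq_abs,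
    sq_abs]
  ring

/-- The hyperplane part does not increase the norm: `‖v − ⟪e₀, v⟫ e₀‖ ≤ ‖v‖` (`‖e₀‖ = 1`). [folklore] -/
theorem norm_sub_inner_smul_le {e₀ : E} (he : ‖e₀‖ = 1) (v : E) : ‖v - ⟪e₀, v⟫_ℝ • e₀‖ ≤ ‖v‖ := by
  have h : ‖v - ⟪e₀, v⟫_ℝ • e₀‖ ^ 2 ≤ ‖v‖ ^ 2 := by
    rw [norm_sub_inner_smul_sq he]
    nlinarith [sq_nonneg ⟪e₀, v⟫_ℝ]
  exact (pow_le_pow_iff_left₀ (norm_nonneg _) (norm_nonneg _) two_ne_zero).1 h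

/-- The hyperplane part is linear: `(v − ⟪e₀, v⟫ e₀) − (w − ⟪e₀, w⟫ e₀) = (v − w) − ⟪e₀, v − w⟫ e₀`. [folklore] -/
theorem sub_inner_smul_sub_sub_inner_smul (e₀ v w : E) :
    (v - ⟪e₀, v⟫_ℝ • e₀) - (w - ⟪e₀, w⟫_ℝ • e₀) = (v - w) - ⟪e₀, v - w⟫_ℝ • e₀ := by
  rw [inner_sub_right, sub_smul]
  abel

/-- The hyperplane part is `1`-Lipschitz: `‖(v − ⟪e₀, v⟫ e₀) − (w − ⟪e₀, w⟫ e₀)‖ ≤ ‖v − w‖` (`‖e₀‖ = 1`). [folklore] -/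
theorem norm_sub_inner_smul_sub_le {e₀ : E} (he : ‖e₀‖ = 1) (v w : E) :
    ‖(v - ⟪e₀, v⟫_ℝ • e₀) - (w - ⟪e₀, w⟫_ℝ • e₀)‖ ≤ ‖v - w‖ := by
  rw [sub_inner_smul_sub_sub_inner_smul]
  exact norm_sub_inner_smul_le he (v - w)

/-! ## §2 The extended maps `Fext v = F (v − ⟪e₀, v⟫ e₀) + (½ ⟪e₀, v⟫) e₀` -/

/-- **The normal component is halved** (one map, pointwise hypothesis): if `F` at the hyperplane part of `v` is
orthogonal to the unit vector `e₀`, then `⟪e₀, F (v − ⟪e₀, v⟫ e₀) + (½ ⟪e₀, v⟫) e₀⟫ = ½ ⟪e₀, v⟫`. [folklore] -/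
theorem inner_Fext' {e₀ : E} (he : ‖e₀‖ = 1) {F : E → E} {v : E} (hF : ⟪e₀, F (v - ⟪e₀, v⟫_ℝ • e₀)⟫_ℝ = 0) :
    ⟪e₀, F (v - ⟪e₀, v⟫_ℝ • e₀) + ((1 / 2 : ℝ) * ⟪e₀, v⟫_ℝ) • e₀⟫_ℝ = (1 / 2 : ℝ) * ⟪e₀, v⟫_ℝ := by
  rw [inner_add_right, hF, real_inner_smul_right, inner_self_eq_one_of_norm_eq_one he, mul_one, zero_add]

/-- **The normal component is halved.**  If the maps `F_k` take values in the hyperplane `⟪e₀, ·⟫ = 0` then the extended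
maps `Fext_k v = F_k (v − ⟪e₀, v⟫ e₀) + (½ ⟪e₀, v⟫) e₀` satisfy `⟪e₀, Fext_k v⟫ = ½ ⟪e₀, v⟫`. [folklore] -/
theorem inner_Fext {e₀ : E} (he : ‖e₀‖ = 1) {F : ℤ → E → E} (hF : ∀ (k : ℤ) (w : E), ⟪e₀, F k w⟫_ℝ = 0) (k : ℤ)
    (v : E) : ⟪e₀, F k (v - ⟪e₀, v⟫_ℝ • e₀) + ((1 / 2 : ℝ) * ⟪e₀, v⟫_ℝ) • e₀⟫_ℝ = (1 / 2 : ℝ) * ⟪e₀, v⟫_ℝ :=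
  inner_Fext' he (hF k _)

/-- **No spurious periodic orbits** (pointwise hypothesis).  Let `v : ℤ → E` be a trajectory of the extended maps,
`Fext_k (v_k) = v_{k+1}`, which is `p`-periodic for some `p ≥ 1`, and assume `F_k` at the hyperplane part of `v_k` is
orthogonal to `e₀` for every `k`.  Then all normal components `c_k = ⟪e₀, v_k⟫` vanish: `c_{k+1} = c_k / 2`, so
`c_k = c_{k+p} = c_k / 2^p`. [folklore] -/
theorem inner_eq_zero_of_periodic_trajectory' {e₀ : E} (he : ‖e₀‖ = 1) {F : ℤ → E → E} {v : ℤ → E}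
    (hF : ∀ k : ℤ, ⟪e₀, F k (v k - ⟪e₀, v k⟫_ℝ • e₀)⟫_ℝ = 0)
    (htraj : ∀ k : ℤ, F k (v k - ⟪e₀, v k⟫_ℝ • e₀) + ((1 / 2 : ℝ) * ⟪e₀, v k⟫_ℝ) • e₀ = v (k + 1))
    {p : ℕ} (hp : 0 < p) (hper : ∀ k : ℤ, v (k + p) = v k) : ∀ k : ℤ, ⟪e₀, v k⟫_ℝ = 0 := by
  have step : ∀ k : ℤ, ⟪e₀, v (k + 1)⟫_ℝ = (1 / 2 : ℝ) * ⟪e₀, v k⟫_ℝ := fun k => by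
    rw [← htraj k]
    exact inner_Fext' he (hF k)
  have iter : ∀ (k : ℤ) (n : ℕ), ⟪e₀, v (k + n)⟫_ℝ = (1 / 2 : ℝ) ^ n * ⟪e₀, v k⟫_ℝ := by
    intro k n
    induction n with
    | zero => simp
    | succ n ih =>
      have hk : k + ((n + 1 : ℕ) : ℤ) = k + n + 1 := by push_cast; ring
      rw [hk, step, ih, pow_succ]
      ring
  intro k
  have h := iter k p
  rw [hper k] at h
  have hlt : (1 / 2 : ℝ) ^ p < 1 := pow_lt_one₀ (by norm_num) (by norm_num) hp.ne'
  have h' : (1 - (1 / 2 : ℝ) ^ p) * ⟪e₀, v k⟫_ℝ = 0 := by linear_combination h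
  exact (mul_eq_zero.1 h').resolve_left (sub_ne_zero.2 hlt.ne')

/-- **No spurious periodic orbits.**  If the maps `F_k` take values in the hyperplane `⟪e₀, ·⟫ = 0` and `v : ℤ → E` is
a `p`-periodic (`p ≥ 1`) trajectory of the extended maps `Fext_k v = F_k (v − ⟪e₀, v⟫ e₀) + (½ ⟪e₀, v⟫) e₀`, then
`⟪e₀, v_k⟫ = 0` for all `k`: the dummy contraction kills the normal components along any periodic orbit. [folklore] -/
theorem inner_eq_zero_of_periodic_trajectory {e₀ : E} (he : ‖e₀‖ = 1) {F : ℤ → E → E}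
    (hF : ∀ (k : ℤ) (w : E), ⟪e₀, F k w⟫_ℝ = 0) {v : ℤ → E}
    (htraj : ∀ k : ℤ, F k (v k - ⟪e₀, v k⟫_ℝ • e₀) + ((1 / 2 : ℝ) * ⟪e₀, v k⟫_ℝ) • e₀ = v (k + 1))
    {p : ℕ} (hp : 0 < p) (hper : ∀ k : ℤ, v (k + p) = v k) : ∀ k : ℤ, ⟪e₀, v k⟫_ℝ = 0 :=
  inner_eq_zero_of_periodic_trajectory' he (fun k => hF k _) htraj hp hper

/-- **No spurious periodic orbits** (maps constrained on a ball only): the same conclusion when `⟪e₀, F_k w⟫ = 0` is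
known for `‖w‖ ≤ Δ` only and the periodic trajectory stays in the `Δ`-ball (the hyperplane part of `v_k` has norm
`≤ ‖v_k‖ ≤ Δ`). [folklore] -/
theorem inner_eq_zero_of_periodic_trajectory_of_norm_le {e₀ : E} (he : ‖e₀‖ = 1) {F : ℤ → E → E} {Δ : ℝ}
    (hF : ∀ (k : ℤ) (w : E), ‖w‖ ≤ Δ → ⟪e₀, F k w⟫_ℝ = 0) {v : ℤ → E} (hv : ∀ k, ‖v k‖ ≤ Δ)
    (htraj : ∀ k : ℤ, F k (v k - ⟪e₀, v k⟫_ℝ • e₀) + ((1 / 2 : ℝ) * ⟪e₀, v k⟫_ℝ) • e₀ = v (k + 1))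
    {p : ℕ} (hp : 0 < p) (hper : ∀ k : ℤ, v (k + p) = v k) : ∀ k : ℤ, ⟪e₀, v k⟫_ℝ = 0 :=
  inner_eq_zero_of_periodic_trajectory' he (fun k => hF k _ ((norm_sub_inner_smul_le he _).trans (hv k))) htraj
    hp hper

/-- **A periodic trajectory of the extension is a trajectory of the hyperplane maps** (pointwise hypothesis): under
the hypotheses of `inner_eq_zero_of_periodic_trajectory'`, `v_k` equals its hyperplane part and `F_k (v_k) = v_{k+1}`.
[folklore] -/
theorem hyperplane_part_of_periodic_trajectory' {e₀ : E} (he : ‖e₀‖ = 1) {F : ℤ → E → E} {v : ℤ → E}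
    (hF : ∀ k : ℤ, ⟪e₀, F k (v k - ⟪e₀, v k⟫_ℝ • e₀)⟫_ℝ = 0)
    (htraj : ∀ k : ℤ, F k (v k - ⟪e₀, v k⟫_ℝ • e₀) + ((1 / 2 : ℝ) * ⟪e₀, v k⟫_ℝ) • e₀ = v (k + 1))
    {p : ℕ} (hp : 0 < p) (hper : ∀ k : ℤ, v (k + p) = v k) :
    (∀ k : ℤ, v k - ⟪e₀, v k⟫_ℝ • e₀ = v k) ∧ ∀ k : ℤ, F k (v k) = v (k + 1) := by
  have h0 := inner_eq_zero_of_periodic_trajectory' he hF htraj hp hper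
  have h1 : ∀ k : ℤ, v k - ⟪e₀, v k⟫_ℝ • e₀ = v k := fun k => by rw [h0 k, zero_smul, sub_zero]
  refine ⟨h1, fun k => ?_⟩
  have h := htraj k
  rwa [h1 k, h0 k, mul_zero, zero_smul, add_zero] at h

/-- **A periodic trajectory of the extension is a trajectory of the hyperplane maps.**  If the `F_k` take values in
the hyperplane `⟪e₀, ·⟫ = 0` and `v` is a `p`-periodic (`p ≥ 1`) trajectory of the extended maps, then `v_k` lies in
the hyperplane (`v_k − ⟪e₀, v_k⟫ e₀ = v_k`) and `F_k (v_k) = v_{k+1}` for all `k`. [folklore] -/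
theorem hyperplane_part_of_periodic_trajectory {e₀ : E} (he : ‖e₀‖ = 1) {F : ℤ → E → E}
    (hF : ∀ (k : ℤ) (w : E), ⟪e₀, F k w⟫_ℝ = 0) {v : ℤ → E}
    (htraj : ∀ k : ℤ, F k (v k - ⟪e₀, v k⟫_ℝ • e₀) + ((1 / 2 : ℝ) * ⟪e₀, v k⟫_ℝ) • e₀ = v (k + 1))
    {p : ℕ} (hp : 0 < p) (hper : ∀ k : ℤ, v (k + p) = v k) :
    (∀ k : ℤ, v k - ⟪e₀, v k⟫_ℝ • e₀ = v k) ∧ ∀ k : ℤ, F k (v k) = v (k + 1) :=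
  hyperplane_part_of_periodic_trajectory' he (fun k => hF k _) htraj hp hper

/-- **A periodic trajectory of the extension is a trajectory of the hyperplane maps** (maps constrained on a ball
only, trajectory in the ball). [folklore] -/
theorem hyperplane_part_of_periodic_trajectory_of_norm_le {e₀ : E} (he : ‖e₀‖ = 1) {F : ℤ → E → E} {Δ : ℝ}
    (hF : ∀ (k : ℤ) (w : E), ‖w‖ ≤ Δ → ⟪e₀, F k w⟫_ℝ = 0) {v : ℤ → E} (hv : ∀ k, ‖v k‖ ≤ Δ)
    (htraj : ∀ k : ℤ, F k (v k - ⟪e₀, v k⟫_ℝ • e₀) + ((1 / 2 : ℝ) * ⟪e₀, v k⟫_ℝ) • e₀ = v (k + 1))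
    {p : ℕ} (hp : 0 < p) (hper : ∀ k : ℤ, v (k + p) = v k) :
    (∀ k : ℤ, v k - ⟪e₀, v k⟫_ℝ • e₀ = v k) ∧ ∀ k : ℤ, F k (v k) = v (k + 1) :=
  hyperplane_part_of_periodic_trajectory' he (fun k => hF k _ ((norm_sub_inner_smul_le he _).trans (hv k))) htraj
    hp hper

/-- **The offsets are unchanged**: `Fext 0 = F 0` (so a bound `‖F_k 0‖ ≤ d` transfers verbatim). [folklore] -/
theorem Fext_zero (e₀ : E) (F : E → E) :
    F (0 - ⟪e₀, (0 : E)⟫_ℝ • e₀) + ((1 / 2 : ℝ) * ⟪e₀, (0 : E)⟫_ℝ) • e₀ = F 0 := by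
  rw [inner_zero_right, zero_smul, sub_zero, mul_zero, zero_smul, add_zero]

/-! ## §3 The extended linear parts `Aext = A ∘ (1 − P₀) + ½ P₀` and the Lipschitz bookkeeping -/

/-- **The extended linear part, evaluated**: with `P₀ := (innerSL ℝ e₀).smulRight e₀` (`P₀ v = ⟪e₀, v⟫ e₀`),
`(A ∘ (1 − P₀) + ½ P₀) v = A (v − ⟪e₀, v⟫ e₀) + (½ ⟪e₀, v⟫) e₀`. [folklore] -/
theorem Aext_apply (A : E →L[ℝ] E) (e₀ v : E) :
    (A.comp (1 - (innerSL ℝ e₀).smulRight e₀) + (1 / 2 : ℝ) • (innerSL ℝ e₀).smulRight e₀ : E →L[ℝ] E) v =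
      A (v - ⟪e₀, v⟫_ℝ • e₀) + ((1 / 2 : ℝ) * ⟪e₀, v⟫_ℝ) • e₀ := by
  simp only [add_apply, ContinuousLinearMap.comp_apply, sub_apply, one_apply_eq_self,
    ContinuousLinearMap.smulRight_apply, innerSL_apply_apply, smul_apply, smul_smul]

/-- `e₀` is an eigenvector of the extended linear part with eigenvalue `½` (`‖e₀‖ = 1`). [folklore] -/
theorem Aext_apply_self (A : E →L[ℝ] E) {e₀ : E} (he : ‖e₀‖ = 1) :
    (A.comp (1 - (innerSL ℝ e₀).smulRight e₀) + (1 / 2 : ℝ) • (innerSL ℝ e₀).smulRight e₀ : E →L[ℝ] E) e₀ =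
      (1 / 2 : ℝ) • e₀ := by
  rw [Aext_apply, inner_self_eq_one_of_norm_eq_one he, one_smul, sub_self, map_zero, zero_add, mul_one]

/-- On the hyperplane `⟪e₀, v⟫ = 0` the extended linear part agrees with `A`. [folklore] -/
theorem Aext_apply_of_inner_eq_zero (A : E →L[ℝ] E) {e₀ v : E} (hv : ⟪e₀, v⟫_ℝ = 0) :
    (A.comp (1 - (innerSL ℝ e₀).smulRight e₀) + (1 / 2 : ℝ) • (innerSL ℝ e₀).smulRight e₀ : E →L[ℝ] E) v =
      A v := by
  rw [Aext_apply, hv, zero_smul, sub_zero, mul_zero, zero_smul, add_zero]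

/-- The complementary projection `1 − P₀`, `v ↦ v − ⟪e₀, v⟫ e₀`, has operator norm `≤ 1` (`‖e₀‖ = 1`). [folklore] -/
theorem norm_one_sub_smulRight_innerSL_le {e₀ : E} (he : ‖e₀‖ = 1) :
    ‖(1 : E →L[ℝ] E) - (innerSL ℝ e₀).smulRight e₀‖ ≤ 1 := by
  refine ContinuousLinearMap.opNorm_le_bound _ zero_le_one fun v => ?_
  rw [one_mul, sub_apply, one_apply_eq_self, ContinuousLinearMap.smulRight_apply, innerSL_apply_apply]
  exact norm_sub_inner_smul_le he v

/-- **Perturbations of the linear parts do not grow under extension**: `‖Aext' − Aext‖ ≤ ‖A' − A‖`, since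
`Aext' − Aext = (A' − A) ∘ (1 − P₀)` and `‖1 − P₀‖ ≤ 1` (so a jump allowance `‖A'_k − A_k‖ ≤ θ` transfers verbatim).
[folklore] -/
theorem norm_Aext_sub_Aext_le (A A' : E →L[ℝ] E) {e₀ : E} (he : ‖e₀‖ = 1) :
    ‖(A'.comp (1 - (innerSL ℝ e₀).smulRight e₀) + (1 / 2 : ℝ) • (innerSL ℝ e₀).smulRight e₀) -
        (A.comp (1 - (innerSL ℝ e₀).smulRight e₀) + (1 / 2 : ℝ) • (innerSL ℝ e₀).smulRight e₀)‖ ≤ ‖A' - A‖ := by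
  have h : (A'.comp (1 - (innerSL ℝ e₀).smulRight e₀) + (1 / 2 : ℝ) • (innerSL ℝ e₀).smulRight e₀) -
      (A.comp (1 - (innerSL ℝ e₀).smulRight e₀) + (1 / 2 : ℝ) • (innerSL ℝ e₀).smulRight e₀) =
      (A' - A).comp (1 - (innerSL ℝ e₀).smulRight e₀) := by
    rw [ContinuousLinearMap.sub_comp]; abel
  rw [h]
  refine (ContinuousLinearMap.opNorm_comp_le _ _).trans ?_
  calc ‖A' - A‖ * ‖(1 : E →L[ℝ] E) - (innerSL ℝ e₀).smulRight e₀‖ ≤ ‖A' - A‖ * 1 :=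
        mul_le_mul_of_nonneg_left (norm_one_sub_smulRight_innerSL_le he) (norm_nonneg _)
    _ = ‖A' - A‖ := mul_one _

/-- **Lipschitz bookkeeping for the dummy stable direction** (one map).  If `F − A` is `κ`-Lipschitz (`κ ≥ 0`) on the
ball `‖v‖ ≤ Δ`, then so is `Fext − Aext`, with the same `κ` and `Δ`: the normal terms `(½ ⟪e₀, v⟫) e₀` cancel exactly,
the hyperplane parts stay in the `Δ`-ball and are `1`-Lipschitz in `v`. [folklore] -/
theorem lipschitz_nonlin_Fext' {e₀ : E} (he : ‖e₀‖ = 1) {F : E → E} {A : E →L[ℝ] E} {κ Δ : ℝ} (hκ : 0 ≤ κ)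
    (hLip : ∀ v v' : E, ‖v‖ ≤ Δ → ‖v'‖ ≤ Δ → ‖(F v - A v) - (F v' - A v')‖ ≤ κ * ‖v - v'‖) :
    ∀ v v' : E, ‖v‖ ≤ Δ → ‖v'‖ ≤ Δ →
      ‖((F (v - ⟪e₀, v⟫_ℝ • e₀) + ((1 / 2 : ℝ) * ⟪e₀, v⟫_ℝ) • e₀) -
            (A.comp (1 - (innerSL ℝ e₀).smulRight e₀) + (1 / 2 : ℝ) • (innerSL ℝ e₀).smulRight e₀ : E →L[ℝ] E) v) -
          ((F (v' - ⟪e₀, v'⟫_ℝ • e₀) + ((1 / 2 : ℝ) * ⟪e₀, v'⟫_ℝ) • e₀) -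
            (A.comp (1 - (innerSL ℝ e₀).smulRight e₀) + (1 / 2 : ℝ) • (innerSL ℝ e₀).smulRight e₀ : E →L[ℝ] E) v')‖ ≤
        κ * ‖v - v'‖ := by
  intro v v' hv hv'
  rw [Aext_apply, Aext_apply, add_sub_add_right_eq_sub, add_sub_add_right_eq_sub]
  refine (hLip _ _ ((norm_sub_inner_smul_le he v).trans hv) ((norm_sub_inner_smul_le he v').trans hv')).trans ?_
  exact mul_le_mul_of_nonneg_left (norm_sub_inner_smul_sub_le he v v') hκ

/-- **Lipschitz bookkeeping for the dummy stable direction.**  If the nonlinear parts `F_k − A_k` are `κ`-Lipschitz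
(`κ ≥ 0`) on the ball `‖v‖ ≤ Δ` for every `k`, then so are the nonlinear parts `Fext_k − Aext_k` of the extended maps,
with the same `κ` and `Δ`.  The conclusion is literally hypothesis `hLip` of
`IsHyperbolicSequence.exists_periodic_shadow_package_of_norm_sub_le` for `φ_k := Fext_k`, `A'_k := Aext_k`.
[folklore] -/
theorem lipschitz_nonlin_Fext {e₀ : E} (he : ‖e₀‖ = 1) {F : ℤ → E → E} {A : ℤ → E →L[ℝ] E} {κ Δ : ℝ}
    (hκ : 0 ≤ κ)
    (hLip : ∀ (k : ℤ) (v v' : E), ‖v‖ ≤ Δ → ‖v'‖ ≤ Δ →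
      ‖(F k v - A k v) - (F k v' - A k v')‖ ≤ κ * ‖v - v'‖) :
    ∀ (k : ℤ) (v v' : E), ‖v‖ ≤ Δ → ‖v'‖ ≤ Δ →
      ‖((F k (v - ⟪e₀, v⟫_ℝ • e₀) + ((1 / 2 : ℝ) * ⟪e₀, v⟫_ℝ) • e₀) -
            ((A k).comp (1 - (innerSL ℝ e₀).smulRight e₀) + (1 / 2 : ℝ) • (innerSL ℝ e₀).smulRight e₀ :
              E →L[ℝ] E) v) -
          ((F k (v' - ⟪e₀, v'⟫_ℝ • e₀) + ((1 / 2 : ℝ) * ⟪e₀, v'⟫_ℝ) • e₀) -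
            ((A k).comp (1 - (innerSL ℝ e₀).smulRight e₀) + (1 / 2 : ℝ) • (innerSL ℝ e₀).smulRight e₀ :
              E →L[ℝ] E) v')‖ ≤
        κ * ‖v - v'‖ :=
  fun k => lipschitz_nonlin_Fext' he hκ (hLip k)

end Literature.Dynamics.Hyperbolic

end
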